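import Summits.QuantumFields.YangMills.Theorems.BalabanUVNodesN19LipschitzLinksMomentLadder
import Summits.QuantumFields.YangMills.Theorems.BalabanUVNodesN19AdditiveLinksLadder

/-!
# YM-DAG node N19 (= NE7 proper) — ONE LADDER WITH MASS FOR ALL FREQUENCIES, GENERAL ADDITIVE LIPSCHITZ STATISTIC `T = Σ_iφ_i(x_i)`
# (module 154 with `Σ|x_i|` replaced by `Σφ_i(x_i)`, `φ_i : [−1,1] → [0,1]` `1`-Lipschitz; the additive Jackson approximant WITH MASS)

Cell `pub-ymgap`, HUMAN RULING D-0062 (Track A) ∕ D-0149 (work-bound push), R141 (C) wider-strategy seat `pub-ymgap-dag-n19-e` (strategy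
s3 = ALTERNATIVE CURRENCY), generation g33, module 14 (lineage module 161).  Route `Summits/QuantumFields/YangMills/Theses/BalabanUVNodes.lean`,
cluster item K3⁸ «SpineGivenEndpointR13SepCoPHV» (stmt-QuantumFields-27366); filed `--supports` that item `--as helper` (it proves no registered
stub).  COUNT-NEUTRAL: [folklore]∕[bookkeeping] over the lineage BY NAME — module 143 (`exists_pair_near_cexp_sum_taylor_mass`), module 144
(`level_mass_le`), module 128 (`mass_plantX_le`), module 127 (`mass_sum_le`, `mass_sub_le`, `mass_C_le`), module 111 (`exists_jacksonPoly_near`),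
module 158 (`abs_additive_sub_half_le`); no laws, no scheme object, no Theses import; NOT a discharge claim.

CONTENT.  §0 `exists_additiveJackson_mass_of_lipschitz`: for `1`-Lipschitz `φ_i : [−1,1] → [0,1]`, `A_M = Σ_i q^{(i)}_M(X_i)` with
`mass A_M ≤ d·M·9^M` and `|Σφ_i(x_i) − A_M(x)| ≤ dπ∕M` (module 128 verbatim per coordinate); §1 `exists_ladder_pairs_near_cexp_additive_mass_uniform` —
module 154 VERBATIM for `T`: ONE `A_J` (`mass ≤ d·2^J·9^{2^J}`, `|T − A_J| ≤ dπ∕2^J`) and, for every `ω ≥ 0`, a pair within `2(J+1)e^{−h}` of `e^{iωA_J}`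
with masses `≤ exp Λ(ωd)`.  The sequel (`…N19AdditiveLinksMomentFirstOrder` ∕ `…MomentBudget`) runs modules 155∕156 for `T`: every `K`-Lipschitz
link of every such additive statistic in the uniform mixed-moment currency at `1.2·10⁵·K·d·log₂³L∕L` — CURRENCY-MAP v7's composition class in
the lineage's principal currency.

HONEST FRAMING (binding).  Elementary and [folklore]; NO consumer in the DAG today (the seat's own currency map); nothing of Bałaban's instantiated; NE7
NOT PRINTED, NOT proved; N19 NOT discharged; count-neutral.  One finite `T⁴` programme at fixed `ε`; nothing continuum ∕ `ℝ⁴` ∕ OS ∕ mass-gap ∕ Clay.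
0 `def` ∕ 0 `sorry`.
-/

noncomputable section

open Finset Complex Polynomial
open scoped Real

namespace Summit.QuantumFields.YangMills.Theorems.BalabanUVNodesN19AdditiveLinksMomentLadder

open Summit.QuantumFields.YangMills.Theorems.BalabanUVNodesN19SingleModeMomentFirstOrder (exists_pair_near_cexp_sum_taylor_mass)
open Summit.QuantumFields.YangMills.Theorems.BalabanUVNodesN19SingleModeMomentFirstOrderLadder (level_mass_le)
open Summit.QuantumFields.YangMills.Theorems.BalabanUVNodesN19SingleModeMomentLadder (mass_plantX_le)
open Summit.QuantumFields.YangMills.Theorems.BalabanUVNodesN19CoefficientMassPricing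
open Summit.QuantumFields.YangMills.Theorems.BalabanUVNodesN19JointLawPriceCompositionsLipschitz (exists_jacksonPoly_near)
open Summit.QuantumFields.YangMills.Theorems.BalabanUVNodesN19AdditiveLinksLadder (abs_additive_sub_half_le)

variable {ι : Type*} [Fintype ι]
variable {φ : ι → ℝ → ℝ}
  (hφL : ∀ i, ∀ u v : ℝ, u ∈ Set.Icc (-1 : ℝ) 1 → v ∈ Set.Icc (-1 : ℝ) 1 → |φ i u - φ i v| ≤ 1 * |u - v|)
  (hφ0 : ∀ i, ∀ u : ℝ, u ∈ Set.Icc (-1 : ℝ) 1 → 0 ≤ φ i u) (hφ1 : ∀ i, ∀ u : ℝ, u ∈ Set.Icc (-1 : ℝ) 1 → φ i u ≤ 1)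

/-! ## §0 The additive Jackson approximant with mass [folklore] -/

include hφL hφ0 hφ1 in
/-- **THE ADDITIVE JACKSON APPROXIMANT OF `Σ_iφ_i(x_i)` WITH MASS.**  For `1`-Lipschitz `φ_i : [−1,1] → [0,1]` and `M ≥ 1`:
`A_M = Σ_i q^{(i)}_M(X_i)` with `mass A_M ≤ d·M·9^M` and `|Σ_iφ_i(x_i) − A_M(x)| ≤ d·π∕M` on `[−1,1]^ι` (module 128 per coordinate). [folklore] -/
theorem exists_additiveJackson_mass_of_lipschitz {M : ℕ} (hM : 0 < M) :
    ∃ A : MvPolynomial ι ℝ, (∑ s ∈ A.support, |A.coeff s|) ≤ Fintype.card ι * (M * 9 ^ M) ∧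
      ∀ x : ι → ℝ, (∀ i, x i ∈ Set.Icc (-1 : ℝ) 1) →
        |(∑ i, φ i (x i)) - MvPolynomial.eval x A| ≤ Fintype.card ι * (π / M) := by
  classical
  have hG : ∀ i, ∀ u : ℝ, u ∈ Set.Icc (-1 : ℝ) 1 → |φ i u| ≤ 1 := fun i u hu => by
    rw [abs_of_nonneg (hφ0 i u hu)]; exact hφ1 i u hu
  choose q hqdeg hqerr hqmass hqbd using fun i => exists_jacksonPoly_near zero_le_one (hφL i) (hG i) hM
  refine ⟨∑ i, ∑ k ∈ range ((q i).natDegree + 1), MvPolynomial.C ((q i).coeff k) * (MvPolynomial.X i) ^ k, ?_, ?_⟩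
  · refine (mass_sum_le _ _).trans ?_
    have hterm : ∀ i : ι, (∑ s ∈ (∑ k ∈ range ((q i).natDegree + 1), MvPolynomial.C ((q i).coeff k) * (MvPolynomial.X i) ^ k).support,
        |(∑ k ∈ range ((q i).natDegree + 1), MvPolynomial.C ((q i).coeff k) * (MvPolynomial.X i) ^ k).coeff s|) ≤ (1 : ℝ) * ((M : ℝ) * 9 ^ M) :=
      fun i => (mass_plantX_le (q i) i).trans (hqmass i _)
    calc _ ≤ ∑ _i : ι, (1 : ℝ) * ((M : ℝ) * 9 ^ M) := Finset.sum_le_sum fun i _ => hterm i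
      _ = Fintype.card ι * (M * 9 ^ M) := by rw [sum_const, card_univ, nsmul_eq_mul, one_mul]
  · intro x hx
    have hsum : MvPolynomial.eval x (∑ i, ∑ k ∈ range ((q i).natDegree + 1), MvPolynomial.C ((q i).coeff k) * (MvPolynomial.X i) ^ k) =
        ∑ i, (q i).eval (x i) := by
      rw [map_sum]
      refine Finset.sum_congr rfl fun i _ => ?_
      rw [map_sum, Polynomial.eval_eq_sum_range]
      exact Finset.sum_congr rfl fun k _ => by rw [map_mul, MvPolynomial.eval_C, map_pow, MvPolynomial.eval_X]
    rw [hsum, ← Finset.sum_sub_distrib]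
    calc |∑ i, (φ i (x i) - (q i).eval (x i))| ≤ ∑ i, |φ i (x i) - (q i).eval (x i)| := abs_sum_le_sum_abs _ _
      _ ≤ ∑ _i : ι, 1 * (π / M) := Finset.sum_le_sum fun i _ => hqerr i _ (hx i)
      _ = Fintype.card ι * (π / M) := by rw [sum_const, card_univ, nsmul_eq_mul, one_mul]

/-! ## §1 One ladder with mass for all frequencies, general additive statistic [folklore] -/

include hφL hφ0 hφ1 in
/-- **ONE LADDER WITH MASS FOR ALL FREQUENCIES, FOR `T = Σ_iφ_i(x_i)`.**  Module 154 verbatim with §0's approximants: for `J : ℕ`, `h ≥ 1` with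
`(J+1)e^{−h} ≤ ½` there is `A` (`mass A ≤ d·2^J·9^{2^J}`, `|T − A| ≤ dπ∕2^J` on the cube) such that for EVERY `ω ≥ 0` there is a pair `(Cr, Ci)`
with masses `≤ exp((J+1)log 2 + (6πe²ωd + h(J+1))log(1 + 10ωd) + (3πe²ωd(J+1) + h(2^{J+1} − 1))log 81)` and
`‖Cr(x) + Ci(x)·i − e^{iωA(x)}‖ ≤ 2(J+1)e^{−h}` on `[−1,1]^ι`. [folklore] -/
theorem exists_ladder_pairs_near_cexp_additive_mass_uniform (J h : ℕ) (hh : 1 ≤ h)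
    (hJh : ((J : ℝ) + 1) * Real.exp (-(h : ℝ)) ≤ 1 / 2) :
    ∃ A : MvPolynomial ι ℝ, (∑ s ∈ A.support, |A.coeff s|) ≤ Fintype.card ι * (2 ^ J * 9 ^ (2 ^ J)) ∧
      (∀ x : ι → ℝ, (∀ i, x i ∈ Set.Icc (-1 : ℝ) 1) → |(∑ i, φ i (x i)) - MvPolynomial.eval x A| ≤ Fintype.card ι * π / 2 ^ J) ∧
      ∀ ω : ℝ, 0 ≤ ω → ∃ Cr Ci : MvPolynomial ι ℝ,
        (∑ s ∈ Cr.support, |Cr.coeff s|) ≤ Real.exp (((J : ℝ) + 1) * Real.log 2 +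
            (6 * π * Real.exp 2 * (ω * Fintype.card ι) + h * ((J : ℝ) + 1)) * Real.log (1 + 10 * (ω * Fintype.card ι)) +
            (3 * π * Real.exp 2 * (ω * Fintype.card ι) * ((J : ℝ) + 1) + h * (2 ^ (J + 1) - 1)) * Real.log 81) ∧
        (∑ s ∈ Ci.support, |Ci.coeff s|) ≤ Real.exp (((J : ℝ) + 1) * Real.log 2 +
            (6 * π * Real.exp 2 * (ω * Fintype.card ι) + h * ((J : ℝ) + 1)) * Real.log (1 + 10 * (ω * Fintype.card ι)) +
            (3 * π * Real.exp 2 * (ω * Fintype.card ι) * ((J : ℝ) + 1) + h * (2 ^ (J + 1) - 1)) * Real.log 81) ∧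
        ∀ x : ι → ℝ, (∀ i, x i ∈ Set.Icc (-1 : ℝ) 1) →
          ‖((MvPolynomial.eval x Cr : ℝ) : ℂ) + ((MvPolynomial.eval x Ci : ℝ) : ℂ) * I -
              exp (((ω * MvPolynomial.eval x A : ℝ) : ℂ) * I)‖ ≤ 2 * ((J : ℝ) + 1) * Real.exp (-(h : ℝ)) := by
  set d : ℝ := (Fintype.card ι : ℝ) with hd
  have hd0 : 0 ≤ d := Nat.cast_nonneg _
  have hπ3 : (3 : ℝ) < π := Real.pi_gt_three
  -- the Jackson ladder with masses
  choose A hAmass hAerr using fun l : ℕ => exists_additiveJackson_mass_of_lipschitz hφL hφ0 hφ1 (M := 2 ^ l) (pow_pos two_pos l)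
  obtain ⟨A', hA'0, hA's⟩ : ∃ A' : ℕ → MvPolynomial ι ℝ, A' 0 = MvPolynomial.C (d / 2) ∧ ∀ l, A' (l + 1) = A l :=
    ⟨fun l => if l = 0 then MvPolynomial.C (d / 2) else A (l - 1), if_pos rfl, fun l => by
      show (if l + 1 = 0 then MvPolynomial.C (d / 2) else A (l + 1 - 1)) = A l
      rw [if_neg (Nat.succ_ne_zero l), Nat.add_sub_cancel]⟩
  obtain ⟨B, hB⟩ : ∃ B : ℕ → MvPolynomial ι ℝ, ∀ l, B l = A l - A' l := ⟨fun l => A l - A' l, fun l => rfl⟩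
  obtain ⟨R, hR0', hRs⟩ : ∃ R : ℕ → ℝ, R 0 = d * (1 / 2 + π) ∧ ∀ l, R (l + 1) = 3 * d * π / 2 ^ (l + 1) :=
    ⟨fun l => if l = 0 then d * (1 / 2 + π) else 3 * d * π / 2 ^ l, if_pos rfl, fun l => if_neg (Nat.succ_ne_zero l)⟩
  obtain ⟨mB, hmB0, hmBs⟩ : ∃ mB : ℕ → ℝ, mB 0 = 10 * d ∧ ∀ l, mB (l + 1) = 2 * d * (2 ^ (l + 1) * 9 ^ (2 ^ (l + 1))) :=
    ⟨fun l => if l = 0 then 10 * d else 2 * d * (2 ^ l * 9 ^ (2 ^ l)), if_pos rfl, fun l => if_neg (Nat.succ_ne_zero l)⟩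
  have hR0 : ∀ l, 0 ≤ R l := by
    intro l; cases l with
    | zero => rw [hR0']; positivity
    | succ l => rw [hRs]; positivity
  -- masses of the increments (module 129)
  have hmassB : ∀ l, l < J + 1 → (∑ s ∈ (B l).support, |(B l).coeff s|) ≤ mB l := by
    intro l _
    rw [hB]
    refine (mass_sub_le _ _).trans ?_
    cases l with
    | zero =>
      rw [hA'0, hmB0]
      have h1 : (∑ s ∈ (A 0).support, |(A 0).coeff s|) ≤ d * 9 := by
        have := hAmass 0; rw [← hd] at this; simpa using this
      have h2 := mass_C_le (ι := ι) (d / 2)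
      rw [abs_of_nonneg (by positivity)] at h2
      linarith
    | succ l =>
      rw [hA's, hmBs]
      have h1 := hAmass (l + 1)
      have h2 := hAmass l
      rw [← hd] at h1 h2
      push_cast at h1 h2 ⊢
      have h3 : (2 : ℝ) ^ l * 9 ^ (2 ^ l) ≤ 2 ^ (l + 1) * 9 ^ (2 ^ (l + 1)) :=
        mul_le_mul (pow_le_pow_right₀ one_le_two (Nat.le_succ l)) (pow_le_pow_right₀ (by norm_num)
          (Nat.pow_le_pow_right two_pos (Nat.le_succ l))) (by positivity) (by positivity)
      have h4 := mul_le_mul_of_nonneg_left h3 hd0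
      linarith
  -- cube bounds of the increments (module 139 §2)
  have hBR : ∀ l, l < J + 1 → ∀ x : ι → ℝ, (∀ i, x i ∈ Set.Icc (-1 : ℝ) 1) → |MvPolynomial.eval x (B l)| ≤ R l := by
    intro l _ x hx
    rw [hB, map_sub]
    cases l with
    | zero =>
      rw [hA'0, hR0', MvPolynomial.eval_C]
      have h1 := hAerr 0 x hx
      have h2 := abs_additive_sub_half_le hφ0 hφ1 x hx
      rw [pow_zero, Nat.cast_one, div_one, ← hd] at h1
      rw [← hd] at h2
      calc |MvPolynomial.eval x (A 0) - d / 2|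
          ≤ |MvPolynomial.eval x (A 0) - (∑ i, φ i (x i))| + |(∑ i, φ i (x i)) - d / 2| := abs_sub_le _ _ _
        _ ≤ d * π + d / 2 := by rw [abs_sub_comm] at h1; exact add_le_add h1 h2
        _ = d * (1 / 2 + π) := by ring
    | succ l =>
      rw [hA's, hRs]
      have h1 := hAerr (l + 1) x hx
      have h2 := hAerr l x hx
      rw [← hd] at h1 h2
      calc |MvPolynomial.eval x (A (l + 1)) - MvPolynomial.eval x (A l)|
          ≤ |MvPolynomial.eval x (A (l + 1)) - (∑ i, φ i (x i))| + |(∑ i, φ i (x i)) - MvPolynomial.eval x (A l)| := abs_sub_le _ _ _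
        _ ≤ d * (π / (2 ^ (l + 1) : ℕ)) + d * (π / (2 ^ l : ℕ)) := by rw [abs_sub_comm] at h1; exact add_le_add h1 h2
        _ = 3 * d * π / 2 ^ (l + 1) := by push_cast; rw [pow_succ]; field_simp; ring
  refine ⟨A J, ?_, fun x hx => ?_, fun ω hω => ?_⟩
  · have := hAmass J; rw [← hd] at this; push_cast at this; exact this
  · have := hAerr J x hx
    rw [← hd] at this; push_cast at this
    calc |(∑ i, φ i (x i)) - MvPolynomial.eval x (A J)| ≤ d * (π / 2 ^ J) := this
      _ = d * π / 2 ^ J := by ring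
  -- the frequency-dependent part: Taylor orders, the ladder, its mass
  set a : ℝ := ω * d with ha
  have ha0 : 0 ≤ a := mul_nonneg hω hd0
  obtain ⟨n, hn⟩ : ∃ n : ℕ → ℕ, ∀ l, n l = ⌈Real.exp 2 * (ω * R l)⌉₊ + h := ⟨fun l => ⌈Real.exp 2 * (ω * R l)⌉₊ + h, fun l => rfl⟩
  have hnl : ∀ l, l < J + 1 → 1 ≤ n l ∧ Real.exp 2 * (ω * R l) ≤ n l := by
    intro l _
    rw [hn]
    refine ⟨hh.trans (Nat.le_add_left h _), ?_⟩
    push_cast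
    exact (Nat.le_ceil _).trans (le_add_of_nonneg_right (Nat.cast_nonneg _))
  have hηl : ∀ l, Real.exp (ω * R l - n l) ≤ Real.exp (-(h : ℝ)) := by
    intro l
    refine Real.exp_le_exp.2 ?_
    rw [hn]; push_cast
    have h1 : ω * R l ≤ Real.exp 2 * (ω * R l) := by
      have : (1 : ℝ) ≤ Real.exp 2 := Real.one_le_exp (by norm_num)
      nlinarith [mul_nonneg hω (hR0 l)]
    have h2 := Nat.le_ceil (Real.exp 2 * (ω * R l))
    linarith
  have hηsum : ∑ l ∈ range (J + 1), Real.exp (ω * R l - n l) ≤ ((J : ℝ) + 1) * Real.exp (-(h : ℝ)) := by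
    calc ∑ l ∈ range (J + 1), Real.exp (ω * R l - n l) ≤ ∑ _l ∈ range (J + 1), Real.exp (-(h : ℝ)) :=
          Finset.sum_le_sum fun l _ => hηl l
      _ = ((J : ℝ) + 1) * Real.exp (-(h : ℝ)) := by rw [sum_const, card_range, nsmul_eq_mul]; push_cast; ring
  -- the Taylor ladder with mass
  obtain ⟨Cr, Ci, hCr, hCi, happ⟩ :=
    exists_pair_near_cexp_sum_taylor_mass (ι := ι) (ω * (d / 2)) hω B mB R n (J + 1) hmassB hBR hnl (hηsum.trans hJh)
  -- the mass of the ladder: `∏_{l≤J} 2(1 + ω m_B(l))^{n_l − 1} ≤ exp Λ`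
  set Λ : ℝ := ((J : ℝ) + 1) * Real.log 2 + (6 * π * Real.exp 2 * a + h * ((J : ℝ) + 1)) * Real.log (1 + 10 * a) +
    (3 * π * Real.exp 2 * a * ((J : ℝ) + 1) + h * (2 ^ (J + 1) - 1)) * Real.log 81 with hΛ
  have hν : ∀ l, ((n l - 1 : ℕ) : ℝ) ≤ 3 * π * Real.exp 2 * a / 2 ^ l + h := by
    intro l
    have hn1 : 1 ≤ n l := by rw [hn]; exact hh.trans (Nat.le_add_left h _)
    rw [Nat.cast_sub hn1, hn]; push_cast
    have hceil : (⌈Real.exp 2 * (ω * R l)⌉₊ : ℝ) < Real.exp 2 * (ω * R l) + 1 :=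
      Nat.ceil_lt_add_one (mul_nonneg (Real.exp_pos _).le (mul_nonneg hω (hR0 l)))
    have hωR : ω * R l ≤ 3 * π * a / 2 ^ l := by
      cases l with
      | zero => rw [hR0', pow_zero, div_one, ha]; nlinarith [mul_nonneg hω hd0]
      | succ l => rw [hRs, ha]; exact le_of_eq (by ring)
    have he0 : 0 ≤ Real.exp 2 := (Real.exp_pos 2).le
    have hT : Real.exp 2 * (ω * R l) ≤ 3 * π * Real.exp 2 * a / 2 ^ l :=
      calc Real.exp 2 * (ω * R l) ≤ Real.exp 2 * (3 * π * a / 2 ^ l) := mul_le_mul_of_nonneg_left hωR he0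
        _ = 3 * π * Real.exp 2 * a / 2 ^ l := by ring
    linarith [hceil, hT]
  have hX1 : ∀ l, 1 + ω * mB l ≤ (1 + 10 * a) * 81 ^ (2 ^ l) := by
    intro l
    have h81 : (1 : ℝ) ≤ 81 ^ (2 ^ l) := one_le_pow₀ (by norm_num)
    cases l with
    | zero => rw [hmB0]; nlinarith [ha0]
    | succ l =>
      rw [hmBs]
      have h29 : (2 : ℝ) ^ (l + 1) * 9 ^ (2 ^ (l + 1)) ≤ 81 ^ (2 ^ (l + 1)) := by
        rw [show (81 : ℝ) = 9 * 9 by norm_num, mul_pow]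
        refine mul_le_mul_of_nonneg_right ?_ (by positivity)
        calc (2 : ℝ) ^ (l + 1) ≤ 9 ^ (l + 1) := pow_le_pow_left₀ zero_le_two (by norm_num) _
          _ ≤ 9 ^ (2 ^ (l + 1)) := pow_le_pow_right₀ (by norm_num) (Nat.lt_two_pow_self).le
      have h1 := mul_le_mul_of_nonneg_left h29 (by positivity : (0 : ℝ) ≤ 2 * a)
      have h81' : (1 : ℝ) ≤ 81 ^ (2 ^ (l + 1)) := one_le_pow₀ (by norm_num)
      have e : ω * (2 * d * (2 ^ (l + 1) * 9 ^ 2 ^ (l + 1))) = 2 * a * (2 ^ (l + 1) * 9 ^ 2 ^ (l + 1)) := by rw [ha]; ring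
      rw [e]
      nlinarith [ha0, h81']
  have hfac : ∀ l ∈ range (J + 1), 2 * (1 + ω * mB l) ^ (n l - 1) ≤
      Real.exp (Real.log 2 + (3 * π * Real.exp 2 * a / 2 ^ l + h) * (Real.log (1 + 10 * a) + 2 ^ l * Real.log 81)) := by
    intro l hl
    have hmB0' : 0 ≤ ω * mB l :=
      mul_nonneg hω ((Finset.sum_nonneg fun s _ => abs_nonneg _).trans (hmassB l (mem_range.1 hl)))
    exact level_mass_le ha0 hmB0' (hX1 l) (hν l)
  have hpos : ∀ l ∈ range (J + 1), 0 ≤ 2 * (1 + ω * mB l) ^ (n l - 1) := by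
    intro l hl
    have hmB0' : 0 ≤ ω * mB l :=
      mul_nonneg hω ((Finset.sum_nonneg fun s _ => abs_nonneg _).trans (hmassB l (mem_range.1 hl)))
    positivity
  have hsum_exp : ∑ l ∈ range (J + 1), (Real.log 2 + (3 * π * Real.exp 2 * a / 2 ^ l + h) * (Real.log (1 + 10 * a) + 2 ^ l * Real.log 81)) ≤ Λ := by
    have hsplit : ∀ l : ℕ, Real.log 2 + (3 * π * Real.exp 2 * a / 2 ^ l + h) * (Real.log (1 + 10 * a) + 2 ^ l * Real.log 81) =
        Real.log 2 + (3 * π * Real.exp 2 * a * Real.log (1 + 10 * a)) * (1 / 2 ^ l) + h * Real.log (1 + 10 * a) +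
          3 * π * Real.exp 2 * a * Real.log 81 + (h * Real.log 81) * 2 ^ l := by
      intro l
      have h2 : (2 : ℝ) ^ l ≠ 0 := pow_ne_zero _ two_ne_zero
      field_simp
      ring
    simp only [hsplit, Finset.sum_add_distrib, Finset.sum_const, card_range, nsmul_eq_mul, ← Finset.mul_sum]
    have hgeo1 : ∑ l ∈ range (J + 1), (1 : ℝ) / 2 ^ l ≤ 2 := by
      have e : ∀ l : ℕ, (1 : ℝ) / 2 ^ l = (1 / 2) ^ l := fun l => by rw [one_div, one_div, inv_pow]
      simp only [e]
      have := geom_sum_eq (x := (1 / 2 : ℝ)) (by norm_num) (J + 1)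
      rw [this]
      have hp : (0 : ℝ) < (1 / 2) ^ (J + 1) := by positivity
      have : ((1 / 2 : ℝ) ^ (J + 1) - 1) / (1 / 2 - 1) = 2 * (1 - (1 / 2) ^ (J + 1)) := by field_simp; ring
      rw [this]; nlinarith
    have hgeo2 : ∑ l ∈ range (J + 1), (2 : ℝ) ^ l = 2 ^ (J + 1) - 1 := by
      have := geom_sum_eq (x := (2 : ℝ)) (by norm_num) (J + 1)
      rw [this]; ring
    rw [hgeo2]
    have hc0 : 0 ≤ 3 * π * Real.exp 2 * a * Real.log (1 + 10 * a) :=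
      mul_nonneg (by positivity) (Real.log_nonneg (by linarith))
    have := mul_le_mul_of_nonneg_left hgeo1 hc0
    rw [hΛ]; push_cast
    nlinarith [this]
  have hmass_tot : ∏ l ∈ range (J + 1), 2 * (1 + ω * mB l) ^ (n l - 1) ≤ Real.exp Λ := by
    calc ∏ l ∈ range (J + 1), 2 * (1 + ω * mB l) ^ (n l - 1)
        ≤ ∏ l ∈ range (J + 1), Real.exp (Real.log 2 + (3 * π * Real.exp 2 * a / 2 ^ l + h) *
            (Real.log (1 + 10 * a) + 2 ^ l * Real.log 81)) := Finset.prod_le_prod hpos hfac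
      _ = Real.exp (∑ l ∈ range (J + 1), (Real.log 2 + (3 * π * Real.exp 2 * a / 2 ^ l + h) *
            (Real.log (1 + 10 * a) + 2 ^ l * Real.log 81))) := (Real.exp_sum _ _).symm
      _ ≤ Real.exp Λ := Real.exp_le_exp.2 hsum_exp
  refine ⟨Cr, Ci, hCr.trans hmass_tot, hCi.trans hmass_tot, fun x hx => ?_⟩
  -- the phase telescopes to `ω·A_J(x)`
  have htel : ω * (d / 2) + ω * ∑ l ∈ range (J + 1), MvPolynomial.eval x (B l) = ω * MvPolynomial.eval x (A J) := by
    have hsumB : ∑ l ∈ range (J + 1), MvPolynomial.eval x (B l) = MvPolynomial.eval x (A J) - d / 2 := by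
      have hsub : ∀ l, MvPolynomial.eval x (B l) = MvPolynomial.eval x (A l) - MvPolynomial.eval x (A' l) := fun l => by
        rw [hB, map_sub]
      simp only [hsub, Finset.sum_sub_distrib]
      rw [Finset.sum_range_succ (fun l => MvPolynomial.eval x (A l)), Finset.sum_range_succ' (fun l => MvPolynomial.eval x (A' l))]
      have hxA'0 : MvPolynomial.eval x (A' 0) = d / 2 := by rw [hA'0, MvPolynomial.eval_C]
      have hxA's : ∀ l, MvPolynomial.eval x (A' (l + 1)) = MvPolynomial.eval x (A l) := fun l => by rw [hA's]
      simp only [hxA'0, hxA's]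
      ring
    rw [hsumB]; ring
  have happ' := happ x hx
  rw [htel] at happ'
  exact happ'.trans (by nlinarith [hηsum, Real.exp_pos (-(h : ℝ))])

end Summit.QuantumFields.YangMills.Theorems.BalabanUVNodesN19AdditiveLinksMomentLadder

end
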